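import Literature.NumberTheory.EllipticCurves.WeilPairingTateDual
import Literature.NumberTheory.GaloisRepresentations.ContinuousCupProductCompat
import HarnessLib

/-!
# The local Weil cup product on `H¹(K_v, E[p])` is SYMMETRIC (KMR 2013 Thm. 3.1 (i)) — the binder
# `hsymm` of the N2 parity law in group currency
# (cell `b2b-bsdres`, unit `b2b-bsdres-x10` = N2 class lead, GEN 31; theorems only, no definition, no
# named fact, nothing booked — glue G2b of `class-closure/N2/P-INSTANCE-ASK-x10g31.md`)

HONEST FRAMING (run/shared/lean/b2b/bsd-rank1-residual/, verbatim in every file): the goal of the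
cell is to DELETE the COMBINATION-SHAPED residual classes of the Birch–Swinnerton-Dyer formula for
ALL analytic-rank `≤ 1` elliptic curves over `ℚ` — "full BSD formula for every rank `≤ 1` curve in
class `C`" assembled STRICTLY from published theorems — so that the rank-`≤ 1` remainder becomes
exactly the CONSTRUCTION-SHAPED classes, which are TYPED (missing-input `Prop`s), NOT attempted.
This is not "finishing BSD". Class X10b (= N2) keeps its label CONSTRUCTION-SHAPED (NEEDS `X_A3`,
referee R82.3 / RESIDUAL-MAP §I N2); this file is a TOOL; no mark / label / tier / count moves.

## What

Klagsbrun–Mazur–Rubin 2013, Thm. 3.1 (i) (Tate): "the local Tate pairings `⟨ , ⟩_v` on `H¹(K_v, T)`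
[induced by a perfect ALTERNATING pairing `T × T → μ_p`] are symmetric". The mechanism is graded
commutativity of the cup product in bidegree `(1, 1)` — `a ∪ b = −(b ∪' a)` for the flipped pairing,
the tree's `ContPairing.cupProduct_comm` (NSW (1.4.4)) — together with skewness of the coefficient
pairing, `e(T, S) = e(S, T)⁻¹`, which makes the flipped pairing the NEGATIVE of the original; two
signs cancel. Team n1011 recorded this as "a short corollary, not yet stated in the tree"
(`GaloisImage/ThreeLagrangianLocalConditions.lean`, binder `hqs`); here it is.

* §1 (any topological group, any continuous pairings) `cupProduct_eq_neg_of_toLin_eq_neg` — two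
  pairings `P, P' : X × Y → Z` with `P' = −P` have `a ∪_{P'} b = −(a ∪_P b)` (the cup-product cocycle
  `(σ, τ) ↦ ⟨f σ, σ g τ⟩` is linear in the pairing); `cupProduct_symm_of_skew` — a SKEW pairing
  `P : X × X → Z` (`⟨y, x⟩ = −⟨x, y⟩`) has a SYMMETRIC cup product on `H¹`: `a ∪ b = b ∪ a`.
* §2 (the Weil pairing) `weilPairingHom_swap` — for `e` with `e(T, S) = e(S, T)⁻¹` the additive
  packaging `weilPairingHom` is skew; `weilCupLocal_symm` — at every place `v` of a number field the
  local Weil cup product `H¹(K_v, E[p]) × H¹(K_v, E[p]) → H²(K_v, μ_p)` (`weilContPairingLocal`) is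
  symmetric; `invWeilCup_symm` — so is `b_v = inv_v(· ∪_{e,v} ·)` for any additive `inv_v`: the
  binder `hsymm` of `X10/ResidualSelmerParityGroupForm.even_add_add_card_groupForm` for the dictionary
  of `X10/ResidualSelmerReciprocity` (`exists_biadditive_invWeilCup`).

The skewness `e(T, S) = e(S, T)⁻¹` is a displayed binder (for the Weil pairing: Silverman *AEC*
III.8.1 (b), alternating ⟹ skew), like the other properties of `e` in the tree's Weil files.

## References

* [KlagsbrunMazurRubin2013] Z. Klagsbrun, B. Mazur, K. Rubin, Ann. of Math. 178 (2013), Thm. 3.1 (i).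
* [NeukirchSchmidtWingberg2008] *Cohomology of Number Fields*, I §4 (1.4.4).
* [SilvermanAEC2009] *AEC*, Prop. III.8.1 (b).
* HOME/class-closure/N2/P-INSTANCE-ASK-x10g31.md (G2b); HOME/X10-AUDIT.md §37.
-/

set_option autoImplicit false

noncomputable section

open scoped Classical

open WeierstrassCurve Field Literature.NumberTheory.EllipticCurves Literature.NumberTheory.GaloisRepresentations
  NumberField
open Literature.NumberTheory.GaloisRepresentations.DiscreteGaloisModule (mu)

namespace Summit.BirchSwinnertonDyer.Rank1Residual.X10.WeilCupSymmetric

universe u v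

/-! ### §1. Cup products of opposite pairings; skew pairings have symmetric cup products -/

section Generic

variable {R : Type u} [CommRing R] [TopologicalSpace R]
variable {G : Type v} [Group G] [TopologicalSpace G] [IsTopologicalGroup G] [LocallyCompactSpace G]
variable {X Y Z : TopRep.{v} R G}

/-- **Opposite pairings have opposite cup products**: if `⟨x, y⟩' = −⟨x, y⟩` for all `x, y` then
`a ∪' b = −(a ∪ b)` on `H¹ × H¹ → H²` (the inhomogeneous cup-product cocycle `(σ, τ) ↦ ⟨f σ, σ g τ⟩`
is linear in the pairing). [cite: NeukirchSchmidtWingberg2008, I §4 (1.4.4)] -/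
theorem cupProduct_eq_neg_of_toLin_eq_neg (P P' : ContPairing X Y Z)
    (h : ∀ (x : X) (y : Y), P'.toLin x y = -P.toLin x y)
    (a : continuousCohomology 1 X) (b : continuousCohomology 1 Y) :
    P'.cupProduct a b = -P.cupProduct a b := by
  obtain ⟨f, rfl⟩ := oneCocycleClass_surjective X a
  obtain ⟨g, rfl⟩ := oneCocycleClass_surjective Y b
  have hc : P'.cupCocycle f g = -P.cupCocycle f g := by
    refine Subtype.ext (ContinuousMap.ext fun στ => ?_)
    obtain ⟨σ, τ⟩ := στ
    rw [Submodule.coe_neg, ContinuousMap.neg_apply, ContPairing.cupCocycle_apply,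
      ContPairing.cupCocycle_apply, h]
  rw [ContPairing.cupProduct_oneCocycleClass_eq_twoCocycleClass,
    ContPairing.cupProduct_oneCocycleClass_eq_twoCocycleClass, hc, twoCocycleClass_neg]

/-- **A skew pairing has a symmetric cup product in bidegree `(1, 1)`**: if `⟨y, x⟩ = −⟨x, y⟩` on
`X × X → Z` then `a ∪ b = b ∪ a` for `a, b ∈ H¹(G, X)` — graded commutativity `a ∪ b = −(b ∪^{flip} a)`
(`ContPairing.cupProduct_comm`) and `flip = −P` (`cupProduct_eq_neg_of_toLin_eq_neg`).
[cite: KlagsbrunMazurRubin2013, Thm. 3.1 (i)] [cite: NeukirchSchmidtWingberg2008, I §4 (1.4.4)] -/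
theorem cupProduct_symm_of_skew (P : ContPairing X X Z) (hskew : ∀ x y : X, P.toLin y x = -P.toLin x y)
    (a b : continuousCohomology 1 X) : P.cupProduct a b = P.cupProduct b a := by
  rw [P.cupProduct_comm a b,
    cupProduct_eq_neg_of_toLin_eq_neg P P.flip (fun x y => by rw [ContPairing.flip_toLin_apply, hskew]) b a,
    neg_neg]

end Generic

/-! ### §2. The Weil pairing: skew coefficients, symmetric local cup products -/

section Weil

-- Cup products need `LocallyCompactSpace Γ_{K_v}` (in the tree a LOCAL instance,
-- `absoluteGaloisGroup_compactSpace`); as in team n1011's files it is an instance HYPOTHESIS here.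

variable {K : Type} [Field K] [NumberField K] (W : WeierstrassCurve K) (p : ℕ) [Fact p.Prime]
  [W.IsElliptic]
variable (e : geomTorsion W p → geomTorsion W p → AlgebraicClosure K)
  (hμ : ∀ S T, e S T ^ p = 1)
  (hadd₁ : ∀ S₁ S₂ T, e (S₁ + S₂) T = e S₁ T * e S₂ T)
  (hadd₂ : ∀ S T₁ T₂, e S (T₁ + T₂) = e S T₁ * e S T₂)
  (hgal : ∀ (σ : absoluteGaloisGroup K) (S T : geomTorsion W p), σ • e S T = e (σ • S) (σ • T))

omit [NumberField K] [W.IsElliptic] in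
/-- A skew `μ_p`-valued pairing (`e(T, S) = e(S, T)⁻¹`, e.g. an alternating one — the Weil pairing,
Silverman III.8.1 (b)) is skew in the additive packaging `weilPairingHom`:
`⟨T, S⟩ = −⟨S, T⟩`. [cite: SilvermanAEC2009, Prop. III.8.1 (b)] -/
theorem weilPairingHom_swap (hskew : ∀ S T, e T S = (e S T)⁻¹) (S T : geomTorsion W p) :
    weilPairingHom W p e hμ hadd₁ hadd₂ T S = -weilPairingHom W p e hμ hadd₁ hadd₂ S T := by
  rw [muCarrier_eq_iff, coe_weilPairingHom, map_neg, toMul_neg, Subgroup.coe_inv, Units.val_inv_eq_inv_val,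
    coe_weilPairingHom, hskew]

omit [W.IsElliptic] in
/-- **The local Weil cup product is symmetric** (KMR Thm. 3.1 (i)): at every place `v`,
`x ∪_{e,v} y = y ∪_{e,v} x` for `x, y ∈ H¹(K_v, E[p])`. [cite: KlagsbrunMazurRubin2013, Thm. 3.1 (i)] -/
theorem weilCupLocal_symm (hskew : ∀ S T, e T S = (e S T)⁻¹) (v : Place K)
    [LocallyCompactSpace (absoluteGaloisGroup (Place.Completion v))]
    (x y : galoisCohomology ((W.torsionGaloisModule p).toLocal v) 1) :
    (weilContPairingLocal W p e hμ hadd₁ hadd₂ hgal v).cupProduct x y =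
      (weilContPairingLocal W p e hμ hadd₁ hadd₂ hgal v).cupProduct y x :=
  cupProduct_symm_of_skew _ (fun S T => by
    rw [weilContPairingLocal_toLin_apply, weilContPairingLocal_toLin_apply]
    exact weilPairingHom_swap W p e hμ hadd₁ hadd₂ hskew S T) x y

omit [W.IsElliptic] in
/-- **`hsymm` for the dictionary `b_v = inv_v(· ∪_{e,v} ·)`** (`X10/ResidualSelmerReciprocity`,
`exists_biadditive_invWeilCup`): for any family of additive maps `inv_v : H²(K_v, μ_p) → ℤ/p` and any
bi-additive `b` agreeing with `inv_v(· ∪_{e,v} ·)`, `b v x y = b v y x`.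
[cite: KlagsbrunMazurRubin2013, Thm. 3.1 (i)] -/
theorem invWeilCup_symm (hskew : ∀ S T, e T S = (e S T)⁻¹)
    [∀ v : Place K, LocallyCompactSpace (absoluteGaloisGroup (Place.Completion v))]
    (inv : ∀ v : Place K, galoisCohomology ((mu K p).toLocal v) 2 →+ ZMod p)
    (b : ∀ v : Place K, galoisCohomology ((W.torsionGaloisModule p).toLocal v) 1 →+
        galoisCohomology ((W.torsionGaloisModule p).toLocal v) 1 →+ ZMod p)
    (hb : ∀ v x y, b v x y = inv v ((weilContPairingLocal W p e hμ hadd₁ hadd₂ hgal v).cupProduct x y))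
    (v : Place K) (x y : galoisCohomology ((W.torsionGaloisModule p).toLocal v) 1) :
    b v x y = b v y x := by
  simp only [hb]
  exact congrArg (inv v) (weilCupLocal_symm W p e hμ hadd₁ hadd₂ hgal hskew v x y)

end Weil

end Summit.BirchSwinnertonDyer.Rank1Residual.X10.WeilCupSymmetric

end
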